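import Summits.QuantumFields.YangMills.Theorems.FluctuationComparisonRegPrIntLS2BetaStageAxialLetters
import Summits.QuantumFields.YangMills.Theorems.FluctuationComparisonRegPrIntLS2BetaDatumGaugeWLOG
import Summits.QuantumFields.YangMills.Theorems.FluctuationComparisonRegPrIntLS2BetaPairingTangentSplit
import Literature.MathematicalPhysics.QuantumFieldTheory.Balaban1983to89.B15Prop1ChartCalculusSU2
import HarnessLib

/-!
# S2β · AVG₂♭-ax_q road, step (4) of UV3-NODE §89.7 — THE STAGE-AXIAL COMB READING: what px12 g24's gauge condition `AxStage` gives a prover of the letter,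
# BY KERNEL — (i) the WLOG to the two stage-tower bottoms (the quaternion-read derivative `DMq`, the chord field and the letter's right side are COVARIANT under a
# common RESIDUAL gauge), (ii) the comb transports of the two level-`j` tower fields ARE those of the two hat LIFTS (top stage: EQUAL), (iii) bondwise: the chord is `1`
# on top-stage comb bonds and equals the LIFTED coarse chord on lower-stage comb bonds

Cell `ym3-torus` (YM ladder rung R3 = continuum `SU(2)` Yang–Mills on the three-torus at fixed lattice data — a RUNG: NOT d = 4, NOT infinite volume, NOT a mass gap,
NOT Clay).  Width seat «width 17» `ym3-torus-px17` (gen 22); crux `stmt-QuantumFields-20520` (`…Theses.UnitScaleTilt.FluctuationComparisonRegPrIntL`), LINE g18-1 S2β,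
organ GAP♯∘ ⟸ … ⟸ AVG₂♭-ax_q (✓p825995's `hM`; Q6 ✓p827555 `avg2_of_taylor`: ⟸ TAYLOR♭_q) with `Ax := AxStage` of record (✓`…S2BetaStageAxialLetters.axStage_exists`,
UV3-NODE §89.2).  `--kind proof --supports stmt-QuantumFields-20520 --as helper`, count-neutral, DEFINITION-FREE (0 `def`, 0 `instance`, 0 `notation`, 0 `sorry`,
default heartbeats).  px16 g22 (lane holder) 15:32:38Z (3) ∕ 15:42:03Z (c): pen (4) → px17 g22.

THE SITUATION.  The letter is asked for a pair `(U, U₀)` — `U₀` an argmin good history, `U` a good fibre mate — under `AxStage F J K hJK U U₀`: there are hat-lift maps `lift j`,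
a fibre mate `U₁`, and two STAGE GAUGE TOWERS `g, g₀` (px17 g19 ✓`exists_stageGaugeTower`, clauses (T0)–(T6)) for `U` and `U₁` with `U₀ = (g_0⁻¹·g₀_0) • U₁`.  Write
`U′_j := g_j • M^jU`, `U₁′_j := g₀_j • M^jU₁` (`M^j = Averaging.iter`), `V_j := lift_j U′_{j+1}`, `V₁_j := lift_j U₁′_{j+1}`.

WHAT IS PROVED (sorry-free).
§1 THE RESIDUAL-GAUGE WLOG (carrier `T³`, `SU(2)`).  For a gauge transformation `h` that is RESIDUAL for the descent (`descendTo (h • X) = descendTo X` for all `X`):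
   `chordField_gaugeAct` (`η(h•U, h•U₀) ℓ = Ad_{h(ℓ₋)} η(U,U₀) ℓ`), `expPoint_adSU2_mul_gaugeAct` (`expPoint (Ad_h ζ) • (h•U₀) = h • (expPoint ζ • U₀)`),
   ★`qRead_gaugeAct_residual` (`Mq(h•U₀) (Ad_h ζ) = Mq(U₀) ζ`), ★★`fderiv_qRead_gaugeAct_residual` (`DMq(h•U₀) (Ad_h ζ) = DMq(U₀) ζ` — chain rule through the bondwise
   `Ad` isometry, NO differentiability hypothesis), ★★`avg2Summand_gaugeAct_residual` (the letter's VECTOR `DMq(U₀) η(U,U₀)` is unchanged under `(U,U₀) ↦ (h•U, h•U₀)`),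
   `sum_dist1_sq_gaugeAct` ∕ `rel_gaugeAct` (both right-side sums unchanged), `residual_of_stageTower` ((T3)+(T1) ⟹ `g_0` is residual), `gaugeAct_bottom_eq`
   (`g_0 • U₀ = g₀_0 • U₁`).  So a prover of AVG₂♭-ax_q ∕ TAYLOR♭_q may ASSUME the pair is `(U′_0, U₁′_0)`, two stage-comb-axial tower bottoms, and that the descended
   pairs are `(U′_j, U₁′_j)` ((T3)).
§2 THE COMB TRANSPORTS (generic `P`, `G`, averagings `av`, lifts `lift`; hypotheses = the (T·) clause TEXTS of ✓`exists_stageGaugeTower` ∕ `AxStage`).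
   `stageField_top_eq` (`g_{j+1} ≡ 1 ≡ g₀_{j+1}` and `M^{j+1}U = M^{j+1}U₁` ⟹ `U′_{j+1} = U₁′_{j+1}`), ★★`axialT_stage_eq_of_top` (then by (T4)×2 the level-`j` COMB TRANSPORTS
   AGREE: `U′_j(Γ_{emb y,x}) = U₁′_j(Γ_{emb y,x})`), ★`axialT_stage_rel_eq_lift_rel` (every stage: `U′_j(Γ)·U₁′_j(Γ)⁻¹ = V_j(Γ)·V₁_j(Γ)⁻¹` — the relative comb transport IS the
   lifts').
§3 BONDWISE, on bonds `⟨x, μ⟩` LYING ON the comb of their block (the field-universal binder of ✓`bond_eq_of_axial`: `∀ W, W(Γ_{emb y, x+e_μ}) = W(Γ_{emb y,x})·W⟨x,μ⟩`,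
   `y = blockOf x = blockOf (x+e_μ)`): ★★`stageField_comb_eq_lift` (`U′_j ⟨x,μ⟩ = V_j ⟨x,μ⟩`), ★★`stageChord_comb_eq_liftChord` (`U′_j b·U₁′_j b⁻¹ = V_j b·V₁_j b⁻¹`: on
   LOWER-stage comb bonds the chord is the LIFTED coarse chord — NOT `1`), ★★★`stageChord_comb_eq_one_of_top` (TOP stage: the chord IS `1` on comb bonds).
   With the geodesic hat lift of `AxStage` (`lift_j X b = expPoint (Σ_e wt_j b e • L⁻¹ • logVec (su2Quat (X e)))`) the lifted chord is `L⁻¹`-small and smooth along each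
   segment; its `ℓ²` price is px12 g24's (R1) ✓`sum_dist1_sq_lift_mul_inv_le` — not repeated here.

HONEST AMENDMENT to UV3-NODE §89.4 (G-axial) «at each stage the pair form sees only straight-segment bonds»: EXACT at the top stage `j = K−J−1`; at stages `j < K−J−1` the
`O(1)`-weight comb bonds carry the lifted level-`(j+1)` chord (§3) — px10 g24 (core) prices it.

INHABITATION (★★OWNER RULING №100): LAW-FREE — group algebra over the `AxStage` witness clauses and the residual-gauge covariance of the (0.4) descent; no fibre law, no
score, no integrability.

HONEST SCOPE.  Bookkeeping (group algebra, one chain rule through a linear isometry); nothing of Bałaban's analysis is asserted or proved ([Balaban1985Averaging] (58) p.27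
«axial gauge conditions in blocks», [Balaban1985Variational] (16)–(18) p.280, [Balaban1985RegularSpaces] (1.19) p.79 are the printed one-level gauges; the STAGE-wise towers are
px8 g21's∕px12 g24's design); AVG₂♭-ax_q ∕ TAYLOR♭_q, (D-ax), h3 HYPOTHESES; «MULT♭-ax»∕«CRIT-ax», GAP♯∘ (`stub_uniformFibreGapOrbit`, registry 3732b7df UNTOUCHED), S2β, the
five registered stubs (0∕5), 20520, 19936, 19200, `YM3TorusSU2` are NOT proved; rung R3 — NOT d = 4, NOT infinite volume, NOT a mass gap, NOT Clay; the Yang–Mills mass gap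
is NOT proved.
-/

set_option autoImplicit false

noncomputable section

open scoped Matrix.Norms.L2Operator Topology RealInnerProductSpace Quaternion
open Set Function
open Literature.MathematicalPhysics.QuantumLattice (su2Quat)
open Literature.MathematicalPhysics.QuantumFieldTheory.Balaban1983to89
open Literature.MathematicalPhysics.QuantumFieldTheory.Balaban1983to89.T4Continuum
open Literature.MathematicalPhysics.QuantumFieldTheory.Balaban1983to89.T3ContinuumYM3Torus
open Literature.MathematicalPhysics.QuantumFieldTheory.Balaban1983to89.T3UnitLawDensityEML (ℰp)
open Literature.MathematicalPhysics.QuantumFieldTheory.Balaban1983to89.T3UnitScaleTilt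
open Literature.MathematicalPhysics.QuantumFieldTheory.Balaban1983to89.T3TiltDescent
open Literature.MathematicalPhysics.QuantumFieldTheory.Balaban1983to89.T3ConstrainedMinimiser (fibre)
open Literature.MathematicalPhysics.QuantumFieldTheory.Balaban1983to89.B10Eq27TorusAxialLog (axialT)
open Literature.MathematicalPhysics.QuantumFieldTheory.Balaban1983to89.BlockAveraging (blockAvg)
open Literature.MathematicalPhysics.QuantumFieldTheory.Balaban1983to89.T4HaarSU2ExpChart (expPoint)
open Literature.MathematicalPhysics.QuantumFieldTheory.Balaban1983to89.T4ExpWindowSmallField (imVec)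
open Literature.MathematicalPhysics.QuantumFieldTheory.Balaban1983to89.B15Prop1ChartSU2 (adSU2 iexp_adSU2 su2Chart_iexp)
open Literature.MathematicalPhysics.QuantumFieldTheory.Balaban1983to89.B15Prop1ChartCalculusSU2 (adSU2_inv_adSU2 adSU2_adSU2_inv)
open Summit.QuantumFields.YangMills.Theorems.FluctuationComparisonRegPrIntLS2BetaStageGaugeTower (bond_eq_of_axial)
open Summit.QuantumFields.YangMills.Theorems.FluctuationComparisonRegPrIntLS2BetaPairingTangentSplit (imVec_su2Quat_conj)
open Summit.QuantumFields.YangMills.Theorems.FluctuationComparisonRegPrIntLS2BetaDatumGaugeWLOG (reTr_rel_plaqHol_gaugeAct_common)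
open Summit.QuantumFields.YangMills.Theorems.FluctuationComparisonRegPrIntLS2BetaResidualGauge (gaugeAct_mul_eq)
open Summit.QuantumFields.YangMills.Theorems.FluctuationComparisonRegPrIntLS2BetaHFlatOfRelativeLetter (residual_of_iter_eq)

namespace Summit.QuantumFields.YangMills.Theorems.FluctuationComparisonRegPrIntLS2BetaStageAxialCombReading

/-! ## §1 The residual-gauge WLOG: `Mq`, `DMq`, the chord field and the letter's right side under a common residual gauge transformation -/

section Residual

variable {F : T3Family} {J K : ℕ} (hJK : J ≤ K)

/-- **THE CHORD FIELD OF A COMMONLY GAUGED PAIR**: `η(h•U, h•U₀) ℓ = Ad_{h(ℓ₋)} (η(U,U₀) ℓ)` (`(h•U)ℓ·((h•U₀)ℓ)⁻¹ = h(ℓ₋)·(U ℓ·U₀ ℓ⁻¹)·h(ℓ₋)⁻¹`).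
[cite: Balaban1985Averaging, (8) p.19; Balaban1989LargeFieldI, (1.77) p.194] -/
theorem chordField_gaugeAct (h : Site (F.P K) 0 → Matrix.specialUnitaryGroup (Fin 2) ℂ)
    (U U₀ : GaugeField (F.P K) 0 (Matrix.specialUnitaryGroup (Fin 2) ℂ)) (ℓ : PBond (F.P K) 0) :
    imVec (su2Quat (GaugeField.gaugeAct h U ℓ * (GaugeField.gaugeAct h U₀ ℓ)⁻¹)) = adSU2 (h ℓ.src) (imVec (su2Quat (U ℓ * (U₀ ℓ)⁻¹))) := by
  have hrew : GaugeField.gaugeAct h U ℓ * (GaugeField.gaugeAct h U₀ ℓ)⁻¹ = h ℓ.src * (U ℓ * (U₀ ℓ)⁻¹) * (h ℓ.src)⁻¹ := by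
    simp only [GaugeField.gaugeAct, mul_inv_rev, inv_inv]
    group
  rw [hrew, imVec_su2Quat_conj]

/-- `expPoint (Ad_g v) = g·expPoint v·g⁻¹` (✓`iexp_adSU2`). [cite: Balaban1989LargeFieldI, (1.77) p.194] -/
theorem expPoint_adSU2 (g : Matrix.specialUnitaryGroup (Fin 2) ℂ) (v : EuclideanSpace ℝ (Fin 3)) :
    expPoint (adSU2 g v) = g * expPoint v * g⁻¹ := by
  have h := iexp_adSU2 g v
  rwa [su2Chart_iexp, su2Chart_iexp] at h

/-- **THE CHART MOVE IS COVARIANT**: `expPoint (Ad_h ζ) • (h • U₀) = h • (expPoint ζ • U₀)` bondwise. [cite: Balaban1985Averaging, (8) p.19; Balaban1989LargeFieldI, (1.77) p.194] -/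
theorem expPoint_adSU2_mul_gaugeAct (h : Site (F.P K) 0 → Matrix.specialUnitaryGroup (Fin 2) ℂ)
    (U₀ : GaugeField (F.P K) 0 (Matrix.specialUnitaryGroup (Fin 2) ℂ)) (ζ : PBond (F.P K) 0 → EuclideanSpace ℝ (Fin 3)) :
    (fun ℓ => expPoint (adSU2 (h ℓ.src) (ζ ℓ)) * GaugeField.gaugeAct h U₀ ℓ : GaugeField (F.P K) 0 (Matrix.specialUnitaryGroup (Fin 2) ℂ)) =
      GaugeField.gaugeAct h (fun ℓ => expPoint (ζ ℓ) * U₀ ℓ) := by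
  funext ℓ
  show expPoint (adSU2 (h ℓ.src) (ζ ℓ)) * (h ℓ.src * U₀ ℓ * (h ℓ.tgt)⁻¹) = h ℓ.src * (expPoint (ζ ℓ) * U₀ ℓ) * (h ℓ.tgt)⁻¹
  rw [expPoint_adSU2]
  group

/-- ★ **`Mq` IS COVARIANT UNDER A RESIDUAL GAUGE**: if `h` is residual for the `(J,K)`-descent then `Mq(h•U₀) (Ad_h ζ) B = Mq(U₀) ζ B`.
[cite: Balaban1987RG1, (0.4), (0.8) p.253; Balaban1985Variational, (3)-(4) p.278] -/
theorem qRead_gaugeAct_residual (h : Site (F.P K) 0 → Matrix.specialUnitaryGroup (Fin 2) ℂ)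
    (hres : ∀ X : GaugeField (F.P K) 0 (Matrix.specialUnitaryGroup (Fin 2) ℂ), descendTo F ℰp J K hJK (GaugeField.gaugeAct h X) = descendTo F ℰp J K hJK X)
    (U₀ : GaugeField (F.P K) 0 (Matrix.specialUnitaryGroup (Fin 2) ℂ)) (ζ : PBond (F.P K) 0 → EuclideanSpace ℝ (Fin 3)) (B : PBond (F.P J) 0) :
    imVec (su2Quat (descendTo F ℰp J K hJK (fun ℓ => expPoint (adSU2 (h ℓ.src) (ζ ℓ)) * GaugeField.gaugeAct h U₀ ℓ) B *
        (descendTo F ℰp J K hJK (GaugeField.gaugeAct h U₀) B)⁻¹)) =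
      imVec (su2Quat (descendTo F ℰp J K hJK (fun ℓ => expPoint (ζ ℓ) * U₀ ℓ) B * (descendTo F ℰp J K hJK U₀ B)⁻¹)) := by
  rw [expPoint_adSU2_mul_gaugeAct, hres, hres]

/-- ★★ **`DMq` IS COVARIANT UNDER A RESIDUAL GAUGE**: `DMq(h•U₀) (Ad_h ζ) = DMq(U₀) ζ` — the chain rule through the bondwise `Ad` isometry (a continuous linear
equivalence), valid for `fderiv` WITHOUT any differentiability hypothesis. [cite: Balaban1987RG1, (0.4), (0.8) p.253; Balaban1989LargeFieldI, (1.77) p.194] -/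
theorem fderiv_qRead_gaugeAct_residual (h : Site (F.P K) 0 → Matrix.specialUnitaryGroup (Fin 2) ℂ)
    (hres : ∀ X : GaugeField (F.P K) 0 (Matrix.specialUnitaryGroup (Fin 2) ℂ), descendTo F ℰp J K hJK (GaugeField.gaugeAct h X) = descendTo F ℰp J K hJK X)
    (U₀ : GaugeField (F.P K) 0 (Matrix.specialUnitaryGroup (Fin 2) ℂ)) (ζ : PBond (F.P K) 0 → EuclideanSpace ℝ (Fin 3)) :
    (fderiv ℝ (fun (ξ : PBond (F.P K) 0 → EuclideanSpace ℝ (Fin 3)) (B : PBond (F.P J) 0) =>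
        imVec (su2Quat (descendTo F ℰp J K hJK (fun ℓ => expPoint (ξ ℓ) * GaugeField.gaugeAct h U₀ ℓ) B *
          (descendTo F ℰp J K hJK (GaugeField.gaugeAct h U₀) B)⁻¹))) 0) (fun ℓ => adSU2 (h ℓ.src) (ζ ℓ)) =
      (fderiv ℝ (fun (ξ : PBond (F.P K) 0 → EuclideanSpace ℝ (Fin 3)) (B : PBond (F.P J) 0) =>
        imVec (su2Quat (descendTo F ℰp J K hJK (fun ℓ => expPoint (ξ ℓ) * U₀ ℓ) B * (descendTo F ℰp J K hJK U₀ B)⁻¹))) 0) ζ := by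
  -- the bondwise `Ad` continuous linear equivalence, built inline (no `def`)
  obtain ⟨A, hA⟩ : ∃ A : (PBond (F.P K) 0 → EuclideanSpace ℝ (Fin 3)) ≃L[ℝ] (PBond (F.P K) 0 → EuclideanSpace ℝ (Fin 3)),
      ∀ ξ ℓ, A ξ ℓ = adSU2 (h ℓ.src) (ξ ℓ) := by
    have e : ∀ ℓ : PBond (F.P K) 0, { e : EuclideanSpace ℝ (Fin 3) ≃L[ℝ] EuclideanSpace ℝ (Fin 3) // ∀ X, e X = adSU2 (h ℓ.src) X } :=
      fun ℓ =>
      ⟨({ adSU2 (h ℓ.src) with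
          invFun := adSU2 (h ℓ.src)⁻¹
          left_inv := adSU2_inv_adSU2 (h ℓ.src)
          right_inv := adSU2_adSU2_inv (h ℓ.src) } : EuclideanSpace ℝ (Fin 3) ≃ₗ[ℝ] EuclideanSpace ℝ (Fin 3)).toContinuousLinearEquiv,
        fun X => rfl⟩
    refine ⟨ContinuousLinearEquiv.piCongrRight fun ℓ => (e ℓ).1, fun ξ ℓ => ?_⟩
    rw [ContinuousLinearEquiv.piCongrRight_apply]
    exact (e ℓ).2 (ξ ℓ)
  set Mh := fun (ξ : PBond (F.P K) 0 → EuclideanSpace ℝ (Fin 3)) (B : PBond (F.P J) 0) =>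
      imVec (su2Quat (descendTo F ℰp J K hJK (fun ℓ => expPoint (ξ ℓ) * GaugeField.gaugeAct h U₀ ℓ) B *
        (descendTo F ℰp J K hJK (GaugeField.gaugeAct h U₀) B)⁻¹)) with hMh
  set M₀ := fun (ξ : PBond (F.P K) 0 → EuclideanSpace ℝ (Fin 3)) (B : PBond (F.P J) 0) =>
      imVec (su2Quat (descendTo F ℰp J K hJK (fun ℓ => expPoint (ξ ℓ) * U₀ ℓ) B * (descendTo F ℰp J K hJK U₀ B)⁻¹)) with hM₀
  have hcomp : M₀ = Mh ∘ ⇑A := by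
    funext ξ B
    simp only [Function.comp_apply, hMh, hM₀]
    have hAξ : (fun ℓ => expPoint (A ξ ℓ) * GaugeField.gaugeAct h U₀ ℓ : GaugeField (F.P K) 0 (Matrix.specialUnitaryGroup (Fin 2) ℂ)) =
        fun ℓ => expPoint (adSU2 (h ℓ.src) (ξ ℓ)) * GaugeField.gaugeAct h U₀ ℓ := by
      funext ℓ; rw [hA]
    rw [hAξ, qRead_gaugeAct_residual hJK h hres U₀ ξ B]
  have hAζ : A ζ = fun ℓ => adSU2 (h ℓ.src) (ζ ℓ) := funext fun ℓ => hA ζ ℓ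
  have hA0 : A 0 = 0 := map_zero A
  rw [hcomp, ContinuousLinearEquiv.comp_right_fderiv, hA0, ContinuousLinearMap.comp_apply, ← hAζ]
  rfl

/-- ★★ **THE LETTER'S VECTOR IS UNCHANGED UNDER A COMMON RESIDUAL GAUGE**: `DMq(h•U₀) η(h•U, h•U₀) = DMq(U₀) η(U,U₀)`.
[cite: Balaban1987RG1, (0.4), (0.8) p.253; Balaban1985Variational, (3)-(4) p.278; Balaban1989LargeFieldI, (1.77) p.194] -/
theorem avg2Vector_gaugeAct_residual (h : Site (F.P K) 0 → Matrix.specialUnitaryGroup (Fin 2) ℂ)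
    (hres : ∀ X : GaugeField (F.P K) 0 (Matrix.specialUnitaryGroup (Fin 2) ℂ), descendTo F ℰp J K hJK (GaugeField.gaugeAct h X) = descendTo F ℰp J K hJK X)
    (U U₀ : GaugeField (F.P K) 0 (Matrix.specialUnitaryGroup (Fin 2) ℂ)) :
    (fderiv ℝ (fun (ξ : PBond (F.P K) 0 → EuclideanSpace ℝ (Fin 3)) (B : PBond (F.P J) 0) =>
        imVec (su2Quat (descendTo F ℰp J K hJK (fun ℓ => expPoint (ξ ℓ) * GaugeField.gaugeAct h U₀ ℓ) B *
          (descendTo F ℰp J K hJK (GaugeField.gaugeAct h U₀) B)⁻¹))) 0)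
        (fun ℓ => imVec (su2Quat (GaugeField.gaugeAct h U ℓ * (GaugeField.gaugeAct h U₀ ℓ)⁻¹))) =
      (fderiv ℝ (fun (ξ : PBond (F.P K) 0 → EuclideanSpace ℝ (Fin 3)) (B : PBond (F.P J) 0) =>
        imVec (su2Quat (descendTo F ℰp J K hJK (fun ℓ => expPoint (ξ ℓ) * U₀ ℓ) B * (descendTo F ℰp J K hJK U₀ B)⁻¹))) 0)
        (fun ℓ => imVec (su2Quat (U ℓ * (U₀ ℓ)⁻¹))) := by
  have hη : (fun ℓ => imVec (su2Quat (GaugeField.gaugeAct h U ℓ * (GaugeField.gaugeAct h U₀ ℓ)⁻¹))) =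
      fun ℓ : PBond (F.P K) 0 => adSU2 (h ℓ.src) (imVec (su2Quat (U ℓ * (U₀ ℓ)⁻¹))) := funext fun ℓ => chordField_gaugeAct h U U₀ ℓ
  rw [hη, fderiv_qRead_gaugeAct_residual hJK h hres U₀]

/-- **THE `d²` SUM IS UNCHANGED** under a common gauge transformation (`dist1` is a class function). [cite: Balaban1985Averaging, (8) p.19] -/
theorem sum_dist1_sq_gaugeAct (h : Site (F.P K) 0 → Matrix.specialUnitaryGroup (Fin 2) ℂ) (U U₀ : GaugeField (F.P K) 0 (Matrix.specialUnitaryGroup (Fin 2) ℂ)) :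
    ∑ ℓ : PBond (F.P K) 0, dist1 (GaugeField.gaugeAct h U ℓ * (GaugeField.gaugeAct h U₀ ℓ)⁻¹) ^ 2 =
      ∑ ℓ : PBond (F.P K) 0, dist1 (U ℓ * (U₀ ℓ)⁻¹) ^ 2 := by
  refine Finset.sum_congr rfl fun ℓ _ => ?_
  have hrew : GaugeField.gaugeAct h U ℓ * (GaugeField.gaugeAct h U₀ ℓ)⁻¹ = h ℓ.src * (U ℓ * (U₀ ℓ)⁻¹) * (h ℓ.src)⁻¹ := by
    simp only [GaugeField.gaugeAct, mul_inv_rev, inv_inv]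
    group
  rw [hrew, GaugeGroup.dist1_conj]

/-- **THE REL SUM IS UNCHANGED** under a common gauge transformation (✓`reTr_rel_plaqHol_gaugeAct_common`). [cite: Balaban1985Averaging, (8)-(9) p.19] -/
theorem rel_gaugeAct (h : Site (F.P K) 0 → Matrix.specialUnitaryGroup (Fin 2) ℂ) (U U₀ : GaugeField (F.P K) 0 (Matrix.specialUnitaryGroup (Fin 2) ℂ)) :
    ∑ p : Plaq (F.P K) 0, (1 - reTr ((GaugeField.plaqHol (GaugeField.gaugeAct h U₀) p)⁻¹ * GaugeField.plaqHol (GaugeField.gaugeAct h U) p)) =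
      ∑ p : Plaq (F.P K) 0, (1 - reTr ((GaugeField.plaqHol U₀ p)⁻¹ * GaugeField.plaqHol U p)) :=
  Finset.sum_congr rfl fun p _ => by rw [reTr_rel_plaqHol_gaugeAct_common]

/-- **THE STAGE GAUGE `g_0` IS RESIDUAL**: from (T3) «`M^j(g_0 • X) = g_j • M^jX` (`j ≤ K−J`)» and (T1) «`g_j ≡ 1` (`j ≥ K−J`)» the descent is `g_0`-invariant.
[cite: Balaban1985Variational, (3)-(4) p.278; Balaban1987RG1, (0.11) p.253] -/
theorem residual_of_stageTower (g : (j : ℕ) → Site (F.P K) j → Matrix.specialUnitaryGroup (Fin 2) ℂ)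
    (hT1 : ∀ j, K - J ≤ j → ∀ y, g j y = 1)
    (hT3 : ∀ X : GaugeField (F.P K) 0 (Matrix.specialUnitaryGroup (Fin 2) ℂ), ∀ j, j ≤ K - J →
      Averaging.iter (fun k => blockAvg (P := F.P K) (j := k) ℰp) j (GaugeField.gaugeAct (g 0) X) =
        GaugeField.gaugeAct (g j) (Averaging.iter (fun k => blockAvg (P := F.P K) (j := k) ℰp) j X)) :
    ∀ X : GaugeField (F.P K) 0 (Matrix.specialUnitaryGroup (Fin 2) ℂ), descendTo F ℰp J K hJK (GaugeField.gaugeAct (g 0) X) = descendTo F ℰp J K hJK X := by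
  refine residual_of_iter_eq F hJK (g 0) fun X => ?_
  have hgm : g (K - J) = fun _ => 1 := funext (hT1 (K - J) le_rfl)
  rw [hT3 X (K - J) le_rfl, hgm, T4AxialGaugeFixing.gaugeAct_const_one]

/-- **THE BOTTOM OF THE SECOND TOWER**: `U₀ = (g_0⁻¹·g₀_0) • U₁` ⟹ `g_0 • U₀ = g₀_0 • U₁`. [cite: Balaban1985Averaging, (8) p.19] -/
theorem gaugeAct_bottom_eq (g₀' g₀₀ : Site (F.P K) 0 → Matrix.specialUnitaryGroup (Fin 2) ℂ)
    (U₀ U₁ : GaugeField (F.P K) 0 (Matrix.specialUnitaryGroup (Fin 2) ℂ)) (hU₀ : U₀ = GaugeField.gaugeAct (fun x => (g₀' x)⁻¹ * g₀₀ x) U₁) :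
    GaugeField.gaugeAct g₀' U₀ = GaugeField.gaugeAct g₀₀ U₁ := by
  rw [hU₀, ← gaugeAct_mul_eq]
  congr 1
  funext x
  show g₀' x * ((g₀' x)⁻¹ * g₀₀ x) = g₀₀ x
  rw [mul_inv_cancel_left]

end Residual

/-! ## §2 The comb transports of the two stage towers are those of the two lifts; at the top stage they agree -/

section Comb

variable {P : Params} {G : Type*} [GaugeGroup G]

/-- **THE TWO TOP FIELDS COINCIDE** for fibre mates: `g_{j+1} ≡ 1 ≡ g₀_{j+1}` and `M^{j+1}U = M^{j+1}U₁` ⟹ `U′_{j+1} = U₁′_{j+1}`. [cite: Balaban1985Variational, (4) p.278] -/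
theorem stageField_top_eq (av : ∀ i, Averaging P i G) {j : ℕ} (g g₀ : (i : ℕ) → Site P i → G) (U U₁ : GaugeField P 0 G)
    (hg : ∀ y, g (j + 1) y = 1) (hg₀ : ∀ y, g₀ (j + 1) y = 1) (hfib : Averaging.iter av (j + 1) U = Averaging.iter av (j + 1) U₁) :
    GaugeField.gaugeAct (g (j + 1)) (Averaging.iter av (j + 1) U) = GaugeField.gaugeAct (g₀ (j + 1)) (Averaging.iter av (j + 1) U₁) := by
  have h1 : g (j + 1) = fun _ => 1 := funext hg
  have h2 : g₀ (j + 1) = fun _ => 1 := funext hg₀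
  rw [h1, h2, T4AxialGaugeFixing.gaugeAct_const_one, T4AxialGaugeFixing.gaugeAct_const_one, hfib]

/-- ★★ **TOP STAGE: THE COMB TRANSPORTS OF THE TWO TOWER FIELDS AGREE.**  (T4) for `(g, U)` and for `(g₀, U₁)` at stage `j`, over the SAME lift maps, plus
`U′_{j+1} = U₁′_{j+1}` (✓`stageField_top_eq`) ⟹ `U′_j(Γ_{emb(blockOf x), x}) = U₁′_j(Γ_{emb(blockOf x), x})` for every site `x`.
[cite: Balaban1985RegularSpaces, (1.19) p.79; Balaban1985Variational, (16)-(18) p.280] -/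
theorem axialT_stage_eq_of_top (av : ∀ i, Averaging P i G) {j : ℕ} (lift : (i : ℕ) → GaugeField P (i + 1) G → GaugeField P i G)
    (g g₀ : (i : ℕ) → Site P i → G) (U U₁ : GaugeField P 0 G)
    (hT4 : ∀ x, axialT (GaugeField.gaugeAct (g j) (Averaging.iter av j U)) (emb (blockOf x)) x =
      axialT (lift j (GaugeField.gaugeAct (g (j + 1)) (Averaging.iter av (j + 1) U))) (emb (blockOf x)) x)
    (hT4' : ∀ x, axialT (GaugeField.gaugeAct (g₀ j) (Averaging.iter av j U₁)) (emb (blockOf x)) x =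
      axialT (lift j (GaugeField.gaugeAct (g₀ (j + 1)) (Averaging.iter av (j + 1) U₁))) (emb (blockOf x)) x)
    (htop : GaugeField.gaugeAct (g (j + 1)) (Averaging.iter av (j + 1) U) = GaugeField.gaugeAct (g₀ (j + 1)) (Averaging.iter av (j + 1) U₁))
    (x : Site P j) :
    axialT (GaugeField.gaugeAct (g j) (Averaging.iter av j U)) (emb (blockOf x)) x =
      axialT (GaugeField.gaugeAct (g₀ j) (Averaging.iter av j U₁)) (emb (blockOf x)) x := by
  rw [hT4 x, hT4' x, htop]

/-- ★ **EVERY STAGE: THE RELATIVE COMB TRANSPORT IS THE LIFTS'**: `U′_j(Γ)·U₁′_j(Γ)⁻¹ = V_j(Γ)·V₁_j(Γ)⁻¹`, `Γ = Γ_{emb(blockOf x), x}` ((T4) twice).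
[cite: Balaban1985RegularSpaces, (1.19) p.79; Balaban1985Variational, (16)-(18) p.280] -/
theorem axialT_stage_rel_eq_lift_rel (av : ∀ i, Averaging P i G) {j : ℕ} (lift : (i : ℕ) → GaugeField P (i + 1) G → GaugeField P i G)
    (g g₀ : (i : ℕ) → Site P i → G) (U U₁ : GaugeField P 0 G)
    (hT4 : ∀ x, axialT (GaugeField.gaugeAct (g j) (Averaging.iter av j U)) (emb (blockOf x)) x =
      axialT (lift j (GaugeField.gaugeAct (g (j + 1)) (Averaging.iter av (j + 1) U))) (emb (blockOf x)) x)
    (hT4' : ∀ x, axialT (GaugeField.gaugeAct (g₀ j) (Averaging.iter av j U₁)) (emb (blockOf x)) x =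
      axialT (lift j (GaugeField.gaugeAct (g₀ (j + 1)) (Averaging.iter av (j + 1) U₁))) (emb (blockOf x)) x)
    (x : Site P j) :
    axialT (GaugeField.gaugeAct (g j) (Averaging.iter av j U)) (emb (blockOf x)) x *
        (axialT (GaugeField.gaugeAct (g₀ j) (Averaging.iter av j U₁)) (emb (blockOf x)) x)⁻¹ =
      axialT (lift j (GaugeField.gaugeAct (g (j + 1)) (Averaging.iter av (j + 1) U))) (emb (blockOf x)) x *
        (axialT (lift j (GaugeField.gaugeAct (g₀ (j + 1)) (Averaging.iter av (j + 1) U₁))) (emb (blockOf x)) x)⁻¹ := by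
  rw [hT4 x, hT4' x]

end Comb

/-! ## §3 Bondwise on comb bonds: the tower field IS the lift there; the chord is the lifted chord; at the top stage it is `1` -/

section Bondwise

variable {P : Params} {G : Type*} [GaugeGroup G]

/-- ★★ **ON A COMB BOND THE STAGE FIELD IS THE LIFT**: (T4) at stage `j` and a bond `⟨x, μ⟩` lying on the comb of its block (field-universal binder, as in
✓`bond_eq_of_axial`; `blockOf (x+e_μ) = blockOf x`) ⟹ `U′_j ⟨x,μ⟩ = V_j ⟨x,μ⟩`, `V_j = lift_j U′_{j+1}`. [cite: Balaban1985RegularSpaces, (1.19) p.79] -/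
theorem stageField_comb_eq_lift (av : ∀ i, Averaging P i G) {j : ℕ} (lift : (i : ℕ) → GaugeField P (i + 1) G → GaugeField P i G)
    (g : (i : ℕ) → Site P i → G) (U : GaugeField P 0 G)
    (hT4 : ∀ x, axialT (GaugeField.gaugeAct (g j) (Averaging.iter av j U)) (emb (blockOf x)) x =
      axialT (lift j (GaugeField.gaugeAct (g (j + 1)) (Averaging.iter av (j + 1) U))) (emb (blockOf x)) x)
    (x : Site P j) (μ : Fin P.d) (hblk : blockOf (x.shift μ) = blockOf x)
    (hcomb : ∀ W : GaugeField P j G, axialT W (emb (blockOf x)) (x.shift μ) = axialT W (emb (blockOf x)) x * W ⟨x, μ⟩) :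
    GaugeField.gaugeAct (g j) (Averaging.iter av j U) ⟨x, μ⟩ = lift j (GaugeField.gaugeAct (g (j + 1)) (Averaging.iter av (j + 1) U)) ⟨x, μ⟩ := by
  have hax' := hT4 (x.shift μ)
  rw [hblk] at hax'
  exact bond_eq_of_axial _ _ (emb (blockOf x)) x μ (hT4 x) hax' (hcomb _) (hcomb _)

/-- ★★ **ON A COMB BOND THE CHORD OF THE TWO TOWERS IS THE LIFTED COARSE CHORD**: `U′_j b·(U₁′_j b)⁻¹ = V_j b·(V₁_j b)⁻¹` — at stages below the top this is NOT `1`.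
[cite: Balaban1985RegularSpaces, (1.19) p.79; Balaban1985Variational, (16)-(18) p.280] -/
theorem stageChord_comb_eq_liftChord (av : ∀ i, Averaging P i G) {j : ℕ} (lift : (i : ℕ) → GaugeField P (i + 1) G → GaugeField P i G)
    (g g₀ : (i : ℕ) → Site P i → G) (U U₁ : GaugeField P 0 G)
    (hT4 : ∀ x, axialT (GaugeField.gaugeAct (g j) (Averaging.iter av j U)) (emb (blockOf x)) x =
      axialT (lift j (GaugeField.gaugeAct (g (j + 1)) (Averaging.iter av (j + 1) U))) (emb (blockOf x)) x)
    (hT4' : ∀ x, axialT (GaugeField.gaugeAct (g₀ j) (Averaging.iter av j U₁)) (emb (blockOf x)) x =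
      axialT (lift j (GaugeField.gaugeAct (g₀ (j + 1)) (Averaging.iter av (j + 1) U₁))) (emb (blockOf x)) x)
    (x : Site P j) (μ : Fin P.d) (hblk : blockOf (x.shift μ) = blockOf x)
    (hcomb : ∀ W : GaugeField P j G, axialT W (emb (blockOf x)) (x.shift μ) = axialT W (emb (blockOf x)) x * W ⟨x, μ⟩) :
    GaugeField.gaugeAct (g j) (Averaging.iter av j U) ⟨x, μ⟩ * (GaugeField.gaugeAct (g₀ j) (Averaging.iter av j U₁) ⟨x, μ⟩)⁻¹ =
      lift j (GaugeField.gaugeAct (g (j + 1)) (Averaging.iter av (j + 1) U)) ⟨x, μ⟩ *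
        (lift j (GaugeField.gaugeAct (g₀ (j + 1)) (Averaging.iter av (j + 1) U₁)) ⟨x, μ⟩)⁻¹ := by
  rw [stageField_comb_eq_lift av lift g U hT4 x μ hblk hcomb, stageField_comb_eq_lift av lift g₀ U₁ hT4' x μ hblk hcomb]

/-- ★★★ **TOP STAGE: THE CHORD IS `1` ON COMB BONDS** — with `U′_{j+1} = U₁′_{j+1}` (fibre mates, `g_{j+1} ≡ 1 ≡ g₀_{j+1}`, ✓`stageField_top_eq`) the two lifts coincide, so
`U′_j ⟨x,μ⟩ = U₁′_j ⟨x,μ⟩` on every comb bond: the (G-axial) gain of UV3-NODE §89.4, EXACT at the top stage. [cite: Balaban1985Averaging, (58) p.27; Balaban1985RegularSpaces, (1.19) p.79] -/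
theorem stageChord_comb_eq_one_of_top (av : ∀ i, Averaging P i G) {j : ℕ} (lift : (i : ℕ) → GaugeField P (i + 1) G → GaugeField P i G)
    (g g₀ : (i : ℕ) → Site P i → G) (U U₁ : GaugeField P 0 G)
    (hT4 : ∀ x, axialT (GaugeField.gaugeAct (g j) (Averaging.iter av j U)) (emb (blockOf x)) x =
      axialT (lift j (GaugeField.gaugeAct (g (j + 1)) (Averaging.iter av (j + 1) U))) (emb (blockOf x)) x)
    (hT4' : ∀ x, axialT (GaugeField.gaugeAct (g₀ j) (Averaging.iter av j U₁)) (emb (blockOf x)) x =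
      axialT (lift j (GaugeField.gaugeAct (g₀ (j + 1)) (Averaging.iter av (j + 1) U₁))) (emb (blockOf x)) x)
    (htop : GaugeField.gaugeAct (g (j + 1)) (Averaging.iter av (j + 1) U) = GaugeField.gaugeAct (g₀ (j + 1)) (Averaging.iter av (j + 1) U₁))
    (x : Site P j) (μ : Fin P.d) (hblk : blockOf (x.shift μ) = blockOf x)
    (hcomb : ∀ W : GaugeField P j G, axialT W (emb (blockOf x)) (x.shift μ) = axialT W (emb (blockOf x)) x * W ⟨x, μ⟩) :
    GaugeField.gaugeAct (g j) (Averaging.iter av j U) ⟨x, μ⟩ = GaugeField.gaugeAct (g₀ j) (Averaging.iter av j U₁) ⟨x, μ⟩ := by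
  rw [stageField_comb_eq_lift av lift g U hT4 x μ hblk hcomb, stageField_comb_eq_lift av lift g₀ U₁ hT4' x μ hblk hcomb, htop]

/-- The same in chord form: `U′_j b·(U₁′_j b)⁻¹ = 1` on top-stage comb bonds. [cite: Balaban1985Averaging, (58) p.27] -/
theorem stageChord_comb_top (av : ∀ i, Averaging P i G) {j : ℕ} (lift : (i : ℕ) → GaugeField P (i + 1) G → GaugeField P i G)
    (g g₀ : (i : ℕ) → Site P i → G) (U U₁ : GaugeField P 0 G)
    (hT4 : ∀ x, axialT (GaugeField.gaugeAct (g j) (Averaging.iter av j U)) (emb (blockOf x)) x =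
      axialT (lift j (GaugeField.gaugeAct (g (j + 1)) (Averaging.iter av (j + 1) U))) (emb (blockOf x)) x)
    (hT4' : ∀ x, axialT (GaugeField.gaugeAct (g₀ j) (Averaging.iter av j U₁)) (emb (blockOf x)) x =
      axialT (lift j (GaugeField.gaugeAct (g₀ (j + 1)) (Averaging.iter av (j + 1) U₁))) (emb (blockOf x)) x)
    (htop : GaugeField.gaugeAct (g (j + 1)) (Averaging.iter av (j + 1) U) = GaugeField.gaugeAct (g₀ (j + 1)) (Averaging.iter av (j + 1) U₁))
    (x : Site P j) (μ : Fin P.d) (hblk : blockOf (x.shift μ) = blockOf x)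
    (hcomb : ∀ W : GaugeField P j G, axialT W (emb (blockOf x)) (x.shift μ) = axialT W (emb (blockOf x)) x * W ⟨x, μ⟩) :
    GaugeField.gaugeAct (g j) (Averaging.iter av j U) ⟨x, μ⟩ * (GaugeField.gaugeAct (g₀ j) (Averaging.iter av j U₁) ⟨x, μ⟩)⁻¹ = 1 := by
  rw [stageChord_comb_eq_one_of_top av lift g g₀ U U₁ hT4 hT4' htop x μ hblk hcomb, mul_inv_cancel]

end Bondwise

end Summit.QuantumFields.YangMills.Theorems.FluctuationComparisonRegPrIntLS2BetaStageAxialCombReading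

end
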